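import Mathlib
import HarnessLib
import HarnessLib.Audit
import Summits.HubbardSuperconductivity.Statement
import Literature.MathematicalPhysics.QuantumLattice.KohnLuttinger
import Literature.MathematicalPhysics.QuantumLattice.DWaveSource
import HarnessLib.Audit.Status.Attr

/-!
Route: VestigialChirality

DORMANT since 2026-08-23T18:09:15Z (reconciler: no traction for 6.1 d (last activity item-evidence-added at 2026-08-17T13:57:32Z); parked, not closed — `ledger route dormant route-HubbardSuperconductivity-VestigialChirality --off` to re) — unstaffed, not closed; items shared with open routes are served there. `ledger route dormant <id> --off` reactivates.

# Route VestigialChirality — prove the Ising shadow (A2g pair chirality) of the d+id window first,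
T>0 then every GS

It suffices to show X (card vestigial-chirality-ising-shadow): for every U0 > 0 there are U in
(0,U0), a hole doping delta in (0,1/2)
(expected within O(U) of the Kohn-Luttinger B1g/B2g crossing delta* ~ 0.4 of the t'=0 band,
RaghuKivelsonScalapino2010 p.7) and c > 0
such that EVERY normalised (N_L,S^z=0)-sector ground-state sequence psi_L of hubbardTorus 2 L 1 U
(the Statement's hypotheses verbatim)
has along even L: (i) the ISING SHADOW = pair-chirality long-range order L^-4 <psi_L, X_L^* X_L
psi_L> >= c eventually, X_L = Sum_x O_chi(x),
O_chi(x) = i(P1(x)^* P2(x) - P2(x)^* P1(x)), P1 = localPair dWaveFormFactor (B1g n.n. singlet pair),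
P2 = the diagonal-bond d_xy singlet
pair (form factor +1 on +-(e1+e2), -1 on +-(e1-e2), weight 1/sqrt2) -- O_chi is Hermitian,
number-conserving (NEUTRAL), spin singlet, A2g,
time-reversal ODD: the Z2 order parameter of a d_(x2-y2) +- i d_xy condensate; and (ii) the
SUBSTANCE = d_(x2-y2) pair-field LRO (the
summit's conclusion verbatim). X = (i) ∧ (ii) at a common weak-coupling point; X -> S by U0 := 1,
dropping (i).
Lean: `∀ U₀ : ℝ, 0 < U₀ → ∃ U ∈ Set.Ioo (0 : ℝ) U₀, ∃ δ ∈ Set.Ioo (0 : ℝ) (1 / 2), ∃ c : ℝ, 0 < c ∧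
∀ (N : ℕ → ℕ) (ψ : ∀ L, Literature.MathematicalPhysics.QuantumLattice.Fock
(Literature.MathematicalPhysics.QuantumLattice.Orb
(Literature.MathematicalPhysics.QuantumLattice.FermionTorus 2 L))), (∀ L, Even L → N L = 2 * ⌊(1 -
δ) * (L : ℝ) ^ 2 / 2⌋₊ ∧ star (ψ L) ⬝ᵥ ψ L = 1 ∧
Literature.MathematicalPhysics.QuantumLattice.IsGroundStateInSector
(Literature.MathematicalPhysics.QuantumLattice.hubbardTorus 2 L 1 U) (N L) 0 (ψ L)) → (∃ L₀ : ℕ, ∀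
(L : ℕ) [NeZero L], Even L → L₀ ≤ L → let B := fun (x :
Literature.Probability.LatticeModels.TorusSite 2 L) (e : Literature.Probability.LatticeModels.Site
2) => Literature.MathematicalPhysics.QuantumLattice.annihilation
(Literature.MathematicalPhysics.QuantumLattice.orb
(Literature.MathematicalPhysics.QuantumLattice.FermionTorus.ofTorusSite x) 0) *
Literature.MathematicalPhysics.QuantumLattice.annihilation
(Literature.MathematicalPhysics.QuantumLattice.orb
(Literature.MathematicalPhysics.QuantumLattice.FermionTorus.ofTorusSite (x +
Literature.Probability.LatticeModels.Torus.proj L e)) 1) -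
Literature.MathematicalPhysics.QuantumLattice.annihilation
(Literature.MathematicalPhysics.QuantumLattice.orb
(Literature.MathematicalPhysics.QuantumLattice.FermionTorus.ofTorusSite x) 1) *
Literature.MathematicalPhysics.QuantumLattice.annihilation
(Literature.MathematicalPhysics.QuantumLattice.orb
(Literature.MathematicalPhysics.QuantumLattice.FermionTorus.ofTorusSite (x +
Literature.Probability.LatticeModels.Torus.proj L e)) 0); let P₂ := fun (x :
Literature.Probability.LatticeModels.TorusSite 2 L) => ((1 / Real.sqrt 2 : ℝ) : ℂ) • (B x ![1, 1] +
B x ![-1, -1] - B x ![1, -1] - B x ![-1, 1]); let P₁ := fun (x :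
Literature.Probability.LatticeModels.TorusSite 2 L) =>
Literature.MathematicalPhysics.QuantumLattice.localPair
Literature.MathematicalPhysics.QuantumLattice.dWaveFormFactor L x; let X := ∑ x :
Literature.Probability.LatticeModels.TorusSite 2 L, Complex.I • (Matrix.conjTranspose (P₁ x) * P₂ x
- Matrix.conjTranspose (P₂ x) * P₁ x); c ≤ (Literature.MathematicalPhysics.QuantumLattice.expect
(Matrix.conjTranspose X * X) (ψ L)).re / ((L : ℕ) : ℝ) ^ 4) ∧
Literature.Probability.LatticeModels.HasLongRangeOrder (fun k =>
Literature.Probability.LatticeModels.halfOpenBox 2 (2 * k)) (fun k =>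
Literature.MathematicalPhysics.QuantumLattice.torusPullback
(Literature.MathematicalPhysics.QuantumLattice.pairFieldCorr
Literature.MathematicalPhysics.QuantumLattice.dWaveFormFactor ψ) (2 * k))`

## Assembly
Pure logic (sorry-free in the planner's Sketch.lean, theorem assembly_holds): X at U0 := 1 gives U
in (0,1), delta in (0,1/2) and, for
every admissible (N, psi), the conjunction (chirality LRO) ∧ (d-wave HasLongRangeOrder); keep the
second conjunct. The cruxes are the
ladder to X, each strictly easier than X and informative on its own: KLChiralCrossing gates the
family (certified, decides in a session);
ThermalChiralOrder is the legal T>0 theorem (Peierls/PS on the relative phase); ChiralGroundStates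
is (i) of X (beta = infinity of the
same expansion + the doublet structure); the substance half (ii) is then the U(1) step in a FULLY
GAPPED d+id background (layer 2; shared
with route ChiralWindow). The card's 'bridge' (chirality => pairing) is deliberately not an item:
every honest localisation of it contains
the pure NODAL d-wave phases (the window centre moves by O(U), its width is O(U^2)), where proving
it means constructing nodal ground states.

Rationale: WHY THIS LINE. Change the order parameter before changing the method: in the chiral d+id
weak-coupling window the condensate breaks U(1) x Z2 (time
reversal), and the Z2 has a LOCAL, NEUTRAL, singlet order parameter O_chi whose order (a) no
catalogued T>0 barrier forbids in d=2
(KomaTasakiPRL1992 / McBryan-Spencer bound charged correlators only), (b) closes by energy-entropy /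
contour expansions with quantum or
complex remainders (BorgsImbrie1989, DattaFernandezFrohlich1996, BorgsKoteckyUeltschi1996, fermionic
BorgsKotecky2000) instead of an
infrared bound without reflection positivity, (c) admits no O(1)-cost gauge-twist witness. Imported:
vestigial/composite order of
multi-component condensates (FernandesOrthSchmalian2019, BojesenBabaevSudbo2014) with its rigorous
effective-model results
(BiskupChayesKivelson2004 discrete shadow at T>0 in 2D; Yuan2024FloatingPhase arXiv:2308.06988: Z2
correlations dominate U(1) ones, T_TRSB
>= T_c), quantum Pirogov-Sinai, certified numerics on the KL kernel (KohnLuttinger.lean vocabulary).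
No prior route targets a discrete
neutral composite or a T>0 order theorem; route ChiralWindow (sibling card) uses d+id only to gap
the nodes for the U(1) proof.

RANKED CRUXES. #0 Target (target) — X as in § Thesis: at a weak-coupling point (for every U0 some
U<U0, delta in (0,1/2), c>0) every sector GS sequence has, along even L, pair-chirality LRO >= c
eventually AND d_(x2-y2) pair-field LRO. (why it might fail: no asymptotic d+id window at t'=0
(KLChiralCrossing false: E pocket at the crossing); the substance half is U(1) ground-state order of
2D lattice fermions (never constructed); every-GS clause.) [RaghuKivelsonScalapino2010,
DengEtAl2015, SimkovicEtAl2016, ArovasBergKivelsonRaghu2022, FernandesOrthSchmalian2019]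
#2 KLChiralCrossing (crux) — THE GATE (certified Kohn-Luttinger computation; card 'What it needs'
regime claim): a bracket [a,b] in (0,1/2) and gamma, U1 > 0 such that for U in (0,U1) the
second-order channel bottoms Lambda(delta,chi) = channelInf (squareDispersion 1 0) (mu(1-delta)) U
chi satisfy: B1g leads B2g by gamma U^2 at delta=a, B2g leads B1g by gamma U^2 at delta=b, and
min(B1g,B2g) + gamma U^2 <= Lambda(chi) for chi not in (B1g,B2g) on all of [a,b] (=> a
jointly-leading B1g/B2g crossing inside (0,1/2); same certified data as route ChiralWindow's
CwKLChiralWindow with partner B2g). [difficulty: M] (why it might fail: LIKELY: at 2nd order, t'=0,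
Hlubina1999, DengEtAl2015 p.2 and SimkovicEtAl2016 p.8 put an E (p', 6 nodes) pocket at 0.5<n<0.65
exactly where B1g,B2g cross (only RKS2010 Fig.tprime0 dissents); pocket closes at U~0.08 only.
P~0.15.) [Hlubina1999, DengEtAl2015, SimkovicEtAl2016, RaghuKivelsonScalapino2010, arXiv:1408.2088,
arXiv:1512.04271]
#3 ThermalChiralOrder (crux) — the POSITIVE-TEMPERATURE SHADOW (card gain G1; the first T>0 ORDER
theorem target for the pure 2D Hubbard model no barrier forbids): for every U0 some U in (0,U0), mu,
beta0, c>0 and a hole-doping bracket [a,b] in (0,1/2) such that for all beta >= beta0 the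
grand-canonical torus Gibbs state gibbsState beta (hubbardTorusWith 2 L 1 U mu) has density 1 -
<N>/L^2 in [a,b] and L^-4 <X_L^* X_L>_beta >= c for all large L, with c UNIFORM in beta (beta =
infinity morally included). [deps: KLChiralCrossing] [difficulty: open-problem] (why it might fail:
K false; or the fermionic effective action for the relative phase has no Peierls condition in a norm
complex-remainder PS tolerates (wall tension ~ rho Delta^2 xi <g1^2 g2^2>/<g^4>, doubly
exponentially small); Cooper log must be crossed first.) [DattaFernandezFrohlich1996,
BorgsKoteckyUeltschi1996, BorgsKotecky2000, BorgsImbrie1989, BiskupChayesKivelson2004,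
Yuan2024FloatingPhase, KomaTasakiPRL1992, BenfattoGiulianiMastropietro2006]
#4 ChiralGroundStates (crux) — the T=0 SHADOW, canonical sector, EVERY ground state (card item
Chi(U,delta); (i) of X alone): for every U0 some U in (0,U0), delta in (0,1/2), c>0 such that every
normalised (N_L,S^z=0)-sector GS sequence of hubbardTorus 2 L 1 U has L^-4 <psi_L, X_L^* X_L psi_L>
>= c for all large even L. [deps: KLChiralCrossing] [difficulty: open-problem] (why it might fail:
as ThermalChiralOrder plus the every-GS clause (an accidental sector degeneracy mixing the
quasi-degenerate chiral doublet with an unrelated level) and canonical-vs-grand-canonical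
equivalence at fixed density.) [DattaFernandezFrohlich1996, BorgsKotecky2000, Tasaki2019Tower,
KomaTasaki1994, RaghuKivelsonScalapino2010]
#5 ChiralPointDWaveOrder (crux; LAYER 2 OF THE TARGET, filed flat at the route-choice repair of
2026-08-16, rev 3) — the construction output at ONE weak-coupling chiral point: for every U0 some U
in (0,U0), delta in (0,1/2), mu and c>0 with (a) the grand-canonical tracial ground-state density of
hubbardTorusWith 2 (L+1) 1 U mu tending to 1-delta, (b) Koma-Tasaki d_(x2-y2) order HasDWaveOrder U
mu (source -h(Delta_d+Delta_d^*), L -> infinity first; the B1g source pins the phase of psi1, the Z2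
chirality is averaged harmlessly by the tracial functional), (c) every normalised (N_L,S^z=0)-sector
GS sequence of hubbardTorus 2 L 1 U at doping delta has pair-chirality LRO >= c for all large even L
(the matrix of #4 verbatim, so #5 => #4). (a),(b) at the SAME point as (c) makes the glue to the
Target pure logic; existential by necessity (the chiral window - centre drifting by O(U) from the
2nd-order crossing, width O(U^2) - cannot be named from certified data) and deliberately not the
'chirality => pairing' implication over a region (see Assembly paragraph of the thesis). [deps:
KLChiralCrossing, ThermalChiralOrder, ChiralGroundStates] [difficulty: open-problem] (why it might
fail: gate likely false (E pocket); no T=0 BCS phase of 2D lattice fermions ever constructed -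
WeakCouplingCeiling below e^(-c/U^2); density matching along ALL L at fixed mu; every-GS clause.)
[RaghuKivelsonScalapino2010, DengEtAl2015, SimkovicEtAl2016, BenfattoGiulianiMastropietro2006,
FeldmanKnorrerTrubowitz2004, KomaTasaki1994, SigristUeda1991, FrankLemm2016, VojtaZhangSachdev2000,
stmt-HubbardSuperconductivity-1740]
#6 SsbToEvenTorusLRO (crux; SHARED item stmt-HubbardSuperconductivity-10439 =
ChiralWindow.CwSsbToEvenTorusLRO verbatim, by Iff.rfl also WeakCouplingBCS.WcbcsSsbToTorusLRO =
NodalWardXY.SsbToTorusLRO, stmt-HubbardSuperconductivity-2009; its crux chain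
Cruxes/CwSsbToEvenTorusLRO is inherited) — there is U0>0 such that for all U in (0,U0), delta in
(0,1/2), mu: IF the grand-canonical ground-state density tends to 1-delta AND HasDWaveOrder U mu
THEN every even-torus (N_L,S^z=0)-sector GS sequence of hubbardTorus 2 L 1 U at doping delta has
d_(x2-y2) pair-field LRO (the summit's matrix at (U,delta)); consumed here only at the fully gapped
chiral point of #5. [deps: ChiralPointDWaveOrder] [difficulty: open-problem] (why it might fail: SSB
under a source => LRO of EVERY finite-volume sector GS is the unproved Koma-Tasaki direction (KT1994
§2.5: only mu1 >= mu2; Conjecture 10); first-order edges; tower mixing.) [KomaTasaki1994,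
Tasaki2019Tower, WreszinskiZagrebnov2016, KaplanHorschVonDerLinden1989]
#9 TargetGlue (support; provable now, kernel-checked in the planner's sketch) —
ChiralPointDWaveOrder -> SsbToEvenTorusLRO -> Target: apply #5 at min(U0, U1), U1 the window of #6;
conjunct (i) of the Target directly, conjunct (ii) through #6 at (U, delta, mu).
#9 ChiralSelectionOddMoments (support) — chiral-not-nematic is automatic in weak coupling (settles
the card's fastest refutation (a)): for g1 in B1g and g2 in B2g the A2g-odd Fermi-curve moments Int
g1^3 g2 dmu_F and Int g1 g2^3 dmu_F vanish (mu_F = fermiCurveMeasure of the D4-symmetric t'=0 band,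
invariant under the axis reflection under which g1 is even and g2 odd; Bochner junk 0 covers
non-integrable cases), so the quartic GL term is const + 4 s^2 t^2 cos^2(phi) Int g1^2 g2^2,
minimised at phi = +-pi/2, and (Int g1^2 g2^2)^2 < Int g1^4 Int g2^4 (Cauchy-Schwarz) is the
coexistence condition. [difficulty: provable-now] [SigristUeda1991, FrankLemm2016,
RaghuKivelsonScalapino2010]

TWO-LAYER PLAN. After KLChiralCrossing lands: ThermalChiralOrder ⇐ EffectiveZ2Action (multiscale
integration to the pairing scale at delta_U near the
crossing, output a Z2 x U(1) lattice action with a Peierls condition on the relative phase and a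
quasi-local complex remainder) →
PeierlsClosure (complex-remainder Pirogov-Sinai, uniform in beta) → ThermalChiralOrder.
ChiralGroundStates ⇐ ThermalChiralOrder-at-
beta=infinity in the canonical sector → DoubletStructure (sector ground space inside the PS chiral
doublet for large even L) →
ChiralGroundStates. Target ⇐ ChiralPointDWaveOrder → SsbToEvenTorusLRO → Target is FILED (rev 3,
route-choice repair: flat at depth 0 with the glue
TargetGlue) — the 'GappedU1Step' made honest as [construction output at ONE point: density-matched
Koma-Tasaki d-wave order AND every-GS
chirality] + [the shared SSB => LRO transfer of ChiralWindow/WeakCouplingBCS/NodalWardXY], not as a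
'chirality => pairing' implication over a
region. Still foreseen, nothing filed (k <= 3 each, one layer below the cruxes):
ChiralPointDWaveOrder ⇐ GapScaleChiralConstruction (the
two-channel construction with the B1g source at delta_U, cf. ChiralWindow.CwChiralConstruction) →
DoubletStructure → ChiralPointDWaveOrder.

KILL CRITERIA. KLChiralCrossing refuted (E, A1g or A2g leads at the B1g=B2g point, or the crossing
sits at delta >= 1/2) ⇒ close `refuted:KLChiralCrossing`
and record for the family 'no asymptotic d+id window at t'=0' (also kills the B2g branch of route
ChiralWindow). A proof that A2g T-odd
neutral LRO is absent from every translation-invariant Gibbs state of the 2D Hubbard model at all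
beta (an overlooked continuous symmetry
acting on O_chi) kills ThermalChiralOrder ⇒ pivot to the T=0 items only. A sector-GS sequence near
the crossing at small U without
chirality LRO makes ChiralGroundStates/Target suspect-false. S proved at weak coupling elsewhere
(WeakCouplingBCS, ChiralWindow) moots
the substance half but not cruxes 3-4, which keep independent value.

NOT DECOMPOSED YET. The multiscale derivation of the effective Z2 x U(1) action (WeakCouplingCeiling
applies head-on, as to WeakCouplingBCS crux 4); the
PS/Peierls closure; the beta = infinity / every-GS passage; the inside of the U(1) step (ii) below
items #5/#6 (sub-gap massive expansion with the source as infrared regulator, any soft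
SSB => LRO inequality); canonical vs grand-canonical equivalence; all
constants (U0, gamma, [a,b], beta0). The card's TwistCovariance remark (no O(1) twist witness
against chirality certificates; corrected
to an O(theta) bound per the novelty audit) is filed informally after open as support.

CHEAPEST FALSIFIER. Evaluate the five second-order channel bottoms of U + U^2 chi_0(k+k') on the
t'=0 Fermi curve for n in [0.5, 0.7] on a fine grid (an
afternoon, non-certified first): if E (p') is below min(B1g,B2g) at the B1g=B2g point — as
Hlubina1999 / DengEtAl2015 / SimkovicEtAl2016
report and RKS2010 does not — KLChiralCrossing is suspect-false and its certified refutation closes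
the route. Not run here (hub is
compute-free; no kit job submitted in this one-shot).

NUMBERS. RKS2010 p.7: d_(x2-y2) for 1 > n > 0.6, d_xy for n < 0.6 (t'=0, O(U^2)). DengEtAl2015 p.2:
p' pocket 0.5 < n < 0.6 at U -> 0, closing at
U ~ 0.08; d/d boundary near-vertical at n ~ 0.6 up to U = 4. SimkovicEtAl2016 p.8: p(6) 'significant
region' at t'=0, n ~ 0.6 (grid
Delta n = 0.05); d_xy^(12) strip at the mirror point n = 1.45. Pairing scale ~ W exp(-1/(alpha rho^2
U^2)) (ArovasBergKivelsonRaghu2022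
§5.1). Items at open: 6 (target, 3 cruxes, 1 support, assembly); after rev 3 (2026-08-16): 10
(target, 5 cruxes of which #6 is shared,
3 supports incl. TargetGlue and the informal TwistCovariance, assembly).

DEFINITION REQUESTS. localPairOn (S : Finset (Site 2)) g L x = Sum_(e in S) (g e/sqrt2)(c_(x up)
c_(x+e down) - c_(x down) c_(x+e up)) generalising localPair
(hard-coded to (0) ∪ unitSteps) + dxyFormFactor (B2g, diagonal steps) in
Literature/MathematicalPhysics/QuantumLattice; pairChirality L x
= I • ((localPair d L x)^* * localPairOn diag dxy L x - h.c.) and totalPairChirality L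
(route-posited objects,
Theorems/VestigialChiralityDefs.lean) with API (Hermitian, commutes with totalNumber and spin, A2g
under d4Act, conjugation-odd). When they
land the `let B / P2 / P1 / X` blocks of ThermalChiralOrder, ChiralGroundStates, Target are re-set
to use them (same meaning).

Novelty: Searches (2026-08-15): `lit search --hybrid "weak coupling phase diagram Hubbard square lattice t'=0
d_xy d_x2-y2 crossover Kohn-Luttinger"` (15 book rows, none relevant; RKS2010 arXiv:1002.0591 p.7,
DengEtAl2015 arXiv:1408.2088 p.2, SimkovicEtAl2016 arXiv:1512.04271 p.8 read); `lit galaxy search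
"vestigial order" --star pdf` (10: arXiv:2308.06988, arXiv:2505.11630, arXiv:1311.5580 relevant);
`lit galaxy search "vestigial" --star all` (36 rows, junk); `lit frontier HubbardSuperconductivity
--since 2020` (30, none on TRSB/vestigial theorems); `lit bridges HubbardSuperconductivity --cross
any` (30, none); crossref lookups for BiskupChayesKivelson2004, BorgsKoteckyUeltschi1996,
BorgsKotecky2000, BorgsImbrie1989; arXiv API rate-limited (429); plus the card's audited search
(refuter-novelty-audit-10).
Nearest prior art found: BiskupChayesKivelson2004 (doi:10.1007/s00023-004-0196-2: rigorous T>0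
discrete nematic order in a 2D O(2) spin model, by RP/chessboard); Yuan2024FloatingPhase
(arXiv:2308.06988 Thms 1-3: no floating phase in U(1)xZ2 XY-class models, T_TRSB >= T_c, any
lattice); BojesenBabaevSudbo2014, FernandesOrthSchmalian2019 (vestigial Z2 physics);
RaghuKivelsonScalapino2010 / ArovasBergKivelsonRaghu2022 §5.1 (d+id at the crossing, non-rigorous);
BorgsKotecky2000 (quantum PS for lattice fermions).
Delta: nobody derives the U(1)xZ2 structure from the PURE Hubbard model at the KL crossing and
targets a theorem of spontaneous time-reversal breaking there (T>0 uniform in beta;  [refs: 10.1007/s00023-004-0196-2:, 1002.0591, 1408.2088, 1512.04271, 2308.06988, 2505.11630, 1311.5580, doi:10.1007/s00023-004-0196-2, DengEtAl2015, SimkovicEtAl2016, BiskupChayesKivelson2004, BorgsKoteckyUeltschi1996, BorgsKotecky2000, BorgsImbrie1989, BojesenBabaevSudbo2014, FernandesOrthSchmalian2019, RaghuKivelsonScalapino2010, ArovasBergKivelsonRaghu2022]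

Barriers (technique_class: vestigial-Z2-order, quantum-Pirogov-Sinai, constructive-RG): - technique_class: vestigial-Z2-order, quantum-Pirogov-Sinai, constructive-RG
- Literature.Barriers.HubbardSuperconductivity.PositiveTemperatureNoPairLRO: EVADED structurally by
ThermalChiralOrder — O_chi commutes with every site gauge rotation used in the
Koma-Tasaki/McBryan-Spencer proof (pattern siteGauge_mul_bondPair_mul on P1^* P2: phases cancel) and
the broken symmetry is discrete; the barrier bounds CHARGED correlators only; the T=0 items never
pass through pair LRO at T>0.
- Literature.Barriers.HubbardSuperconductivity.HohenbergMerminWagnerPairing: same evasion (neutral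
composite, discrete symmetry); its bond-pair scope caveat concerns charged pairs.
- Literature.Barriers.HubbardSuperconductivity.LROForcesLowLyingStates: does not bite on the shadow
— O_chi conserves the charge, a discrete order parameter forces only an exponentially split doublet
(the chiral cat), not a tower; the every-GS clause of ChiralGroundStates is the named residual risk;
for the substance half it applies as to every route (no uniform-gap continuation is used).
- Literature.Barriers.HubbardSuperconductivity.WeakCouplingCeiling: it does not evade it; the bet
(shared with WeakCouplingBCS crux 4 / ChiralWindow crux 2) is a two-regime expansion — convergent
down to K e^(-C/U^2), then symmetry-broken around the FULLY GAPPED d+id reference — and that a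
Peierls condition on a Z2 variable is strictly less to ask of the infrared end than U(1) order.
- Literature.Barriers.HubbardSuperconductivity.Perturb

Novelty grade: new-combination — ROUTE REVIEW (refuter gen3 2026-08-15; consolidates c064b68f, 6bad857d g0-g2, grounder g12-14; per-item briefings on the items). STATEMENTS: all 6 typed decls rc0; hypotheses = Statement's verbatim, non-vacuous; Target(ii) = summit conclusion; Assembly PROVED (evidence on 2421); ChiralSelectionOddMo (refuter refuter-rreview-route-HubbardSuperconduc-6bad857d-g3-0, 2026-08-15T14:48:18Z; prior: arXiv:1512.04271, arXiv:1408.2088, Hlubina1999, arXiv:1002.0591, doi:10.1007/s00023-004-0196-2, doi:10.1103/physrevb.110.054519, doi:10.1103/physrevb.107.104514, FernandesOrthSchmalian2019, BojesenBabaevSudbo2014, BorgsKotecky2000, DattaFernandezFrohlich1996, BorgsKoteckyUeltschi1996, BorgsImbrie1989, arXiv:2308.06988)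

History (route lifecycle, newest last):
- 2026-08-16T04:07:27Z · AUTO-CRUX (backfill): Target — hypotheses of the deciding theorem that nothing in the route derives are cruxes (operator:999:1085951)
- 2026-08-23T18:09:15Z · DORMANT — reconciler: no traction for 6.1 d (last activity item-evidence-added at 2026-08-17T13:57:32Z); parked, not closed — `ledger route dormant route-HubbardSupercond (operator:999:2417323)

sub-problem: HubbardSuperconductivity · status: dormant · opened planner-plancard-HubbardSuperconductivity-Hub-5e99907c-0 2026-08-15T11:04:07Z · rev 4 · ledger route-HubbardSuperconductivity-VestigialChirality
GENERATED by the gate from the ledger (D-0016/17). Provers cite these decls: `theorem foo : Summit.HubbardSuperconductivity.HubbardSuperconductivity.Theses.VestigialChirality.<Decl> := …` in Summits/HubbardSuperconductivity/HubbardSuperconductivity/Theorems/<Name>.lean.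
-/

namespace Summit.HubbardSuperconductivity.HubbardSuperconductivity.Theses.VestigialChirality

open scoped BigOperators Topology Manifold Classical MeasureTheory ProbabilityTheory Matrix InnerProductSpace ComplexConjugate ContinuousMap
open Filter Set Function TopologicalSpace MeasureTheory

attribute [summit_statement] _root_.HubbardSuperconductivity

open Literature.Hubbard

/-- item stmt-HubbardSuperconductivity-2416 · crux (kind.auto-crux: conjecture-grade) · rank 0 · open · by planner
why it might fail: Asymptotic (∀U₀ ∃U<U₀) d+id window at t'=0 likely absent: at O(U²) an E/p⁽⁶⁾ pocket separates d_xy from d_x²-y² (Hlubina1999; DengEtAl2015 p.2; SimkovicEtAl2016 p.10), so conjunct (i) fails at every small U; (ii) = U(1) pair LRO of EVERY sector GS of 2D lattice fermions, never constructed.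
sources: RaghuKivelsonScalapino2010, DengEtAl2015, SimkovicEtAl2016, Hlubina1999, ArovasBergKivelsonRaghu2022, FernandesOrthSchmalian2019
[target] X as in § Thesis: at a weak-coupling point (for every U0 some U<U0, delta in (0,1/2), c>0)
every sector GS sequence has, along even L, pair-chirality LRO >= c eventually AND d_(x2-y2)
pair-field LRO. -/
@[route_item "route-HubbardSuperconductivity-VestigialChirality", crux]
def Target : Prop :=
  ∀ U₀ : ℝ, 0 < U₀ → ∃ U ∈ Set.Ioo (0 : ℝ) U₀, ∃ δ ∈ Set.Ioo (0 : ℝ) (1 / 2), ∃ c : ℝ, 0 < c ∧ ∀ (N : ℕ → ℕ) (ψ : ∀ L, Literature.MathematicalPhysics.QuantumLattice.Fock (Literature.MathematicalPhysics.QuantumLattice.Orb (Literature.MathematicalPhysics.QuantumLattice.FermionTorus 2 L))), (∀ L, Even L → N L = 2 * ⌊(1 - δ) * (L : ℝ) ^ 2 / 2⌋₊ ∧ star (ψ L) ⬝ᵥ ψ L = 1 ∧ Literature.MathematicalPhysics.QuantumLattice.IsGroundStateInSector (Literature.MathematicalPhysics.QuantumLattice.hubbardTorus 2 L 1 U) (N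 L) 0 (ψ L)) → (∃ L₀ : ℕ, ∀ (L : ℕ) [NeZero L], Even L → L₀ ≤ L → let B := fun (x : Literature.Probability.LatticeModels.TorusSite 2 L) (e : Literature.Probability.LatticeModels.Site 2) => Literature.MathematicalPhysics.QuantumLattice.annihilation (Literature.MathematicalPhysics.QuantumLattice.orb (Literature.MathematicalPhysics.QuantumLattice.FermionTorus.ofTorusSite x) 0) * Literature.MathematicalPhysics.QuantumLattice.annihilation (Literature.MathematicalPhysics.QuantumLattice.orb (Literature.MathematicalPhysics.QuantumLattice.FermionTorus.ofTorusSite (x + Literature.Probability.LatticeModels.Torus.proj L e)) 1) - Literature.MathematicalPhysics.QuantumLattice.annihilation (Literature.MathematicalPhysics.QuantumLattice.orb (Literature.MathematicalPhysics.QuantumLattice.FermionTorus.ofTorusSite x) 1) * Literature.MathematicalPhysics.QuantumLattice.annihilation (Literature.MathematicalPhysics.QuantumLattice.orb (Literature.MathematicalPhysics.QuantumLattice.FermionTorus.ofTorusSite (x + Literature.Probability.LatticeModels.Torus.proj L e)) 0); let P₂ := fun (x : Literature.Probability.LatticeModels.TorusSite 2 L) => ((1 / Real.sqrt 2 : ℝ)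 : ℂ) • (B x ![1, 1] + B x ![-1, -1] - B x ![1, -1] - B x ![-1, 1]); let P₁ := fun (x : Literature.Probability.LatticeModels.TorusSite 2 L) => Literature.MathematicalPhysics.QuantumLattice.localPair Literature.MathematicalPhysics.QuantumLattice.dWaveFormFactor L x; let X := ∑ x : Literature.Probability.LatticeModels.TorusSite 2 L, Complex.I • (Matrix.conjTranspose (P₁ x) * P₂ x - Matrix.conjTranspose (P₂ x) * P₁ x); c ≤ (Literature.MathematicalPhysics.QuantumLattice.expect (Matrix.conjTranspose X * X) (ψ L)).re / ((L : ℕ) : ℝ) ^ 4) ∧ Literature.Probability.LatticeModels.HasLongRangeOrder (fun k => Literature.Probability.LatticeModels.halfOpenBox 2 (2 * k)) (fun k => Literature.MathematicalPhysics.QuantumLattice.torusPullback (Literature.MathematicalPhysics.QuantumLattice.pairFieldCorr Literature.MathematicalPhysics.QuantumLattice.dWaveFormFactor ψ) (2 * k))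

/-- item stmt-HubbardSuperconductivity-2417 · crux · rank 2 · open · by planner
why it might fail: LIKELY FALSE at O(U²), t'=0: Hlubina1999, DengEtAl2015 p.2 (p′ pocket 0.5<n<0.6, closing only at U≳0.08) and SimkovicEtAl2016 p.10 ('p⁽⁶⁾ overlooked in RKS2010: too few harmonics') put the E bottom (= triplet −U²χ(k−k′) on odd ψ) below B1g=B2g at their crossing, violating the χ∉{B1g,B2g} clause.
sources: Hlubina1999, DengEtAl2015, SimkovicEtAl2016, RaghuKivelsonScalapino2010, arXiv:1408.2088, arXiv:1512.04271
[crux] THE GATE (certified Kohn-Luttinger computation; card 'What it needs' regime claim): a bracket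
[a,b] in (0,1/2) and gamma, U1 > 0 such that for U in (0,U1) the second-order channel bottoms
Lambda(delta,chi) = channelInf (squareDispersion 1 0) (mu(1-delta)) U chi satisfy: B1g leads B2g by
gamma U^2 at delta=a, B2g leads B1g by gamma U^2 at delta=b, and min(B1g,B2g) + gamma U^2 <=
Lambda(chi) for chi not in (B1g,B2g) on all of [a,b] (=> a jointly-leading B1g/B2g crossing inside
(0,1/2); same certified data as route ChiralWindow's CwKLChiralWindow with partner B2g).
[difficulty: M] -/
@[route_item "route-HubbardSuperconductivity-VestigialChirality"]
def KLChiralCrossing : Prop :=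
  ∃ a b γ U₁ : ℝ, 0 < a ∧ a < b ∧ b < 1 / 2 ∧ 0 < γ ∧ 0 < U₁ ∧ ∀ U ∈ Set.Ioo (0 : ℝ) U₁, Literature.MathematicalPhysics.QuantumLattice.channelInf (Literature.MathematicalPhysics.QuantumLattice.squareDispersion 1 0) (Literature.MathematicalPhysics.QuantumLattice.chemicalPotentialOfDensity (Literature.MathematicalPhysics.QuantumLattice.squareDispersion 1 0) (1 - a)) U Literature.MathematicalPhysics.QuantumLattice.D4Irrep.B1g + γ * U ^ 2 ≤ Literature.MathematicalPhysics.QuantumLattice.channelInf (Literature.MathematicalPhysics.QuantumLattice.squareDispersion 1 0) (Literature.MathematicalPhysics.QuantumLattice.chemicalPotentialOfDensity (Literature.MathematicalPhysics.QuantumLattice.squareDispersion 1 0) (1 - a)) U Literature.MathematicalPhysics.QuantumLattice.D4Irrep.B2g ∧ Literature.MathematicalPhysics.QuantumLattice.channelInf (Literature.MathematicalPhysics.QuantumLattice.squareDispersion 1 0) (Literature.MathematicalPhysics.QuantumLattice.chemicalPotentialOfDensity (Literature.MathematicalPhysics.QuantumLattice.squareDispersion 1 0) (1 - b)) U Literature.MathematicalPhysics.QuantumLattice.D4Irrep.B2g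 + γ * U ^ 2 ≤ Literature.MathematicalPhysics.QuantumLattice.channelInf (Literature.MathematicalPhysics.QuantumLattice.squareDispersion 1 0) (Literature.MathematicalPhysics.QuantumLattice.chemicalPotentialOfDensity (Literature.MathematicalPhysics.QuantumLattice.squareDispersion 1 0) (1 - b)) U Literature.MathematicalPhysics.QuantumLattice.D4Irrep.B1g ∧ ∀ δ ∈ Set.Icc a b, ∀ χ : Literature.MathematicalPhysics.QuantumLattice.D4Irrep, χ ≠ Literature.MathematicalPhysics.QuantumLattice.D4Irrep.B1g → χ ≠ Literature.MathematicalPhysics.QuantumLattice.D4Irrep.B2g → min (Literature.MathematicalPhysics.QuantumLattice.channelInf (Literature.MathematicalPhysics.QuantumLattice.squareDispersion 1 0) (Literature.MathematicalPhysics.QuantumLattice.chemicalPotentialOfDensity (Literature.MathematicalPhysics.QuantumLattice.squareDispersion 1 0) (1 - δ)) U Literature.MathematicalPhysics.QuantumLattice.D4Irrep.B1g) (Literature.MathematicalPhysics.QuantumLattice.channelInf (Literature.MathematicalPhysics.QuantumLattice.squareDispersion 1 0) (Literature.MathematicalPhysics.QuantumLattice.chemicalPotentialOfDensity (Literature.MathematicalPhysics.QuantumLattice.squareDispersion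 1 0) (1 - δ)) U Literature.MathematicalPhysics.QuantumLattice.D4Irrep.B2g) + γ * U ^ 2 ≤ Literature.MathematicalPhysics.QuantumLattice.channelInf (Literature.MathematicalPhysics.QuantumLattice.squareDispersion 1 0) (Literature.MathematicalPhysics.QuantumLattice.chemicalPotentialOfDensity (Literature.MathematicalPhysics.QuantumLattice.squareDispersion 1 0) (1 - δ)) U χ

/-- item stmt-HubbardSuperconductivity-2418 · crux · rank 3 · open · by planner
why it might fail: Gate likely false (E pocket). Even granted: the Gibbs state must be controlled BELOW the BCS scale e^{-c/U²} (WeakCouplingCeiling; BGM2006 stops above), then a Peierls/PS bound on the relative B1g/B2g phase with a gapless U(1) mode + vortices in contour weights (BorgsKotecky2000: gapped GS only).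
sources: DattaFernandezFrohlich1996, BorgsKoteckyUeltschi1996, BorgsKotecky2000, BorgsImbrie1989, BiskupChayesKivelson2004, Yuan2024FloatingPhase
[crux] the POSITIVE-TEMPERATURE SHADOW (card gain G1; the first T>0 ORDER theorem target for the
pure 2D Hubbard model no barrier forbids): for every U0 some U in (0,U0), mu, beta0, c>0 and a
hole-doping bracket [a,b] in (0,1/2) such that for all beta >= beta0 the grand-canonical torus Gibbs
state gibbsState beta (hubbardTorusWith 2 L 1 U mu) has density 1 - <N>/L^2 in [a,b] and L^-4 <X_L^*
X_L>_beta >= c for all large L, with c UNIFORM in beta (beta = infinity morally included). [deps: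
KLChiralCrossing] [difficulty: open-problem] -/
@[route_item "route-HubbardSuperconductivity-VestigialChirality"]
def ThermalChiralOrder : Prop :=
  ∀ U₀ : ℝ, 0 < U₀ → ∃ U ∈ Set.Ioo (0 : ℝ) U₀, ∃ μ β₀ c a b : ℝ, 0 < c ∧ 0 < a ∧ a ≤ b ∧ b < 1 / 2 ∧ ∀ β : ℝ, β₀ ≤ β → ∃ L₀ : ℕ, ∀ (L : ℕ) [NeZero L], L₀ ≤ L → 1 - (Matrix.gibbsState β (Literature.MathematicalPhysics.QuantumLattice.hubbardTorusWith 2 L 1 U μ) Literature.MathematicalPhysics.QuantumLattice.totalNumber).re / ((L : ℕ) : ℝ) ^ 2 ∈ Set.Icc a b ∧ let B := fun (x : Literature.Probability.LatticeModels.TorusSite 2 L) (e : Literature.Probability.LatticeModels.Site 2) => Literature.MathematicalPhysics.QuantumLattice.annihilation (Literature.MathematicalPhysics.QuantumLattice.orb (Literature.MathematicalPhysics.QuantumLattice.FermionTorus.ofTorusSite x) 0) * Literature.MathematicalPhysics.QuantumLattice.annihilation (Literature.MathematicalPhysics.QuantumLattice.orb (Literature.MathematicalPhysics.QuantumLattice.FermionTorus.ofTorusSite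 (x + Literature.Probability.LatticeModels.Torus.proj L e)) 1) - Literature.MathematicalPhysics.QuantumLattice.annihilation (Literature.MathematicalPhysics.QuantumLattice.orb (Literature.MathematicalPhysics.QuantumLattice.FermionTorus.ofTorusSite x) 1) * Literature.MathematicalPhysics.QuantumLattice.annihilation (Literature.MathematicalPhysics.QuantumLattice.orb (Literature.MathematicalPhysics.QuantumLattice.FermionTorus.ofTorusSite (x + Literature.Probability.LatticeModels.Torus.proj L e)) 0); let P₂ := fun (x : Literature.Probability.LatticeModels.TorusSite 2 L) => ((1 / Real.sqrt 2 : ℝ) : ℂ) • (B x ![1, 1] + B x ![-1, -1] - B x ![1, -1] - B x ![-1, 1]); let P₁ := fun (x : Literature.Probability.LatticeModels.TorusSite 2 L) => Literature.MathematicalPhysics.QuantumLattice.localPair Literature.MathematicalPhysics.QuantumLattice.dWaveFormFactor L x; let X := ∑ x : Literature.Probability.LatticeModels.TorusSite 2 L, Complex.I • (Matrix.conjTranspose (P₁ x) * P₂ x - Matrix.conjTranspose (P₂ x) * P₁ x); c ≤ (Matrix.gibbsState β (Literature.MathematicalPhysics.QuantumLattice.hubbardTorusWith 2 L 1 U μ)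 (Matrix.conjTranspose X * X)).re / ((L : ℕ) : ℝ) ^ 4

/-- item stmt-HubbardSuperconductivity-2419 · crux · rank 4 · open · by planner
why it might fail: ThermalChiralOrder's risks at β=∞, plus: EVERY (N_L,S^z=0) GS on even tori must lie in the chiral-doublet span — an accidental degeneracy with a non-chiral level (other momentum/D₄ sector; nematic d+d′ at the edge of a δ-window shrinking with U) breaks it; canonical↔grand-canonical at fixed N.
sources: DattaFernandezFrohlich1996, BorgsKotecky2000, Tasaki2019Tower, KomaTasaki1994, RaghuKivelsonScalapino2010
[crux] the T=0 SHADOW, canonical sector, EVERY ground state (card item Chi(U,delta); (i) of X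
alone): for every U0 some U in (0,U0), delta in (0,1/2), c>0 such that every normalised
(N_L,S^z=0)-sector GS sequence of hubbardTorus 2 L 1 U has L^-4 <psi_L, X_L^* X_L psi_L> >= c for
all large even L. [deps: KLChiralCrossing] [difficulty: open-problem] -/
@[route_item "route-HubbardSuperconductivity-VestigialChirality"]
def ChiralGroundStates : Prop :=
  ∀ U₀ : ℝ, 0 < U₀ → ∃ U ∈ Set.Ioo (0 : ℝ) U₀, ∃ δ ∈ Set.Ioo (0 : ℝ) (1 / 2), ∃ c : ℝ, 0 < c ∧ ∀ (N : ℕ → ℕ) (ψ : ∀ L, Literature.MathematicalPhysics.QuantumLattice.Fock (Literature.MathematicalPhysics.QuantumLattice.Orb (Literature.MathematicalPhysics.QuantumLattice.FermionTorus 2 L))), (∀ L, Even L → N L = 2 * ⌊(1 - δ) * (L : ℝ) ^ 2 / 2⌋₊ ∧ star (ψ L) ⬝ᵥ ψ L = 1 ∧ Literature.MathematicalPhysics.QuantumLattice.IsGroundStateInSector (Literature.MathematicalPhysics.QuantumLattice.hubbardTorus 2 L 1 U) (N L) 0 (ψ L)) → ∃ L₀ : ℕ, ∀ (L : ℕ)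 [NeZero L], Even L → L₀ ≤ L → let B := fun (x : Literature.Probability.LatticeModels.TorusSite 2 L) (e : Literature.Probability.LatticeModels.Site 2) => Literature.MathematicalPhysics.QuantumLattice.annihilation (Literature.MathematicalPhysics.QuantumLattice.orb (Literature.MathematicalPhysics.QuantumLattice.FermionTorus.ofTorusSite x) 0) * Literature.MathematicalPhysics.QuantumLattice.annihilation (Literature.MathematicalPhysics.QuantumLattice.orb (Literature.MathematicalPhysics.QuantumLattice.FermionTorus.ofTorusSite (x + Literature.Probability.LatticeModels.Torus.proj L e)) 1) - Literature.MathematicalPhysics.QuantumLattice.annihilation (Literature.MathematicalPhysics.QuantumLattice.orb (Literature.MathematicalPhysics.QuantumLattice.FermionTorus.ofTorusSite x) 1) * Literature.MathematicalPhysics.QuantumLattice.annihilation (Literature.MathematicalPhysics.QuantumLattice.orb (Literature.MathematicalPhysics.QuantumLattice.FermionTorus.ofTorusSite (x + Literature.Probability.LatticeModels.Torus.proj L e)) 0); let P₂ := fun (x : Literature.Probability.LatticeModels.TorusSite 2 L) => ((1 / Real.sqrt 2 : ℝ) : ℂ) • (B x ![1, 1] + B x ![-1, -1] - B x ![1, -1]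 - B x ![-1, 1]); let P₁ := fun (x : Literature.Probability.LatticeModels.TorusSite 2 L) => Literature.MathematicalPhysics.QuantumLattice.localPair Literature.MathematicalPhysics.QuantumLattice.dWaveFormFactor L x; let X := ∑ x : Literature.Probability.LatticeModels.TorusSite 2 L, Complex.I • (Matrix.conjTranspose (P₁ x) * P₂ x - Matrix.conjTranspose (P₂ x) * P₁ x); c ≤ (Literature.MathematicalPhysics.QuantumLattice.expect (Matrix.conjTranspose X * X) (ψ L)).re / ((L : ℕ) : ℝ) ^ 4

/-- item stmt-HubbardSuperconductivity-14380 · crux · rank 5 · open · by planner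
why it might fail: Gate likely false (E pocket at the B1g=B2g crossing, t'=0); no T=0 BCS phase of 2D lattice fermions ever constructed (WeakCouplingCeiling below e^{-c/U²}); density matching along ALL L at fixed μ, and the every-GS chirality clause can break on an accidental sector degeneracy.
sources: RaghuKivelsonScalapino2010 (arXiv:1002.0591 §III, Fig. tprime0 p. 7), DengEtAl2015 (arXiv:1408.2088 p. 2), SimkovicEtAl2016 (arXiv:1512.04271 pp. 8-10), BenfattoGiulianiMastropietro2006 (Thm 1.1), FeldmanKnorrerTrubowitz2004, KomaTasaki1994 (§1, §2.5)
[crux] LAYER 2 OF THE TARGET, filed flat at the route-choice repair of 2026-08-16 (the header's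
'GappedU1Step' made honest): the construction output at ONE weak-coupling chiral point. For every
U0>0 there are U in (0,U0), delta in (0,1/2), mu and c>0 such that (a) the grand-canonical tracial
ground-state density of hubbardTorusWith 2 (L+1) 1 U mu tends to 1-delta (density matching, all side
lengths, verbatim the hypothesis of SsbToEvenTorusLRO), (b) Koma-Tasaki d_(x2-y2) order
HasDWaveOrder U mu (source -h(Delta_d+Delta_d^*), L->infinity first, then h->0+: the B1g source pins
the phase of the B1g component psi1 of the d+id condensate, the Z2 chirality is averaged harmlessly
by the tracial functional), and (c) every normalised (N_L,S^z=0)-sector ground-state sequence of the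
source-free canonical model hubbardTorus 2 L 1 U at doping delta has pair-chirality LRO L^-4 <psi_L,
X_L^* X_L psi_L> >= c for all large even L (the matrix of ChiralGroundStates verbatim, so this item
implies ChiralGroundStates by dropping (a),(b); checked in the planner's Sketch.lean). (a) and (b)
at the SAME point as (c) is what makes the glue to Target pure logic. Stated existentially (one
point; for all U0 so -/
@[route_item "route-HubbardSuperconductivity-VestigialChirality"]
def ChiralPointDWaveOrder : Prop :=
  ∀ U₀ : ℝ, 0 < U₀ → ∃ U ∈ Set.Ioo (0 : ℝ) U₀, ∃ δ ∈ Set.Ioo (0 : ℝ) (1 / 2), ∃ μ c : ℝ, 0 < c ∧ Filter.Tendsto (fun L : ℕ => ((Literature.MathematicalPhysics.QuantumLattice.hubbardTorusWith 2 (L + 1) 1 U μ).groundStateFunctional Literature.MathematicalPhysics.QuantumLattice.totalNumber).re / ((L + 1 : ℕ) : ℝ) ^ 2) Filter.atTop (nhds (1 - δ)) ∧ Literature.MathematicalPhysics.QuantumLattice.HasDWaveOrder U μ ∧ ∀ (N : ℕ → ℕ) (ψ : ∀ L, Literature.MathematicalPhysics.QuantumLattice.Fock (Literature.MathematicalPhysics.QuantumLattice.Orb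 (Literature.MathematicalPhysics.QuantumLattice.FermionTorus 2 L))), (∀ L, Even L → N L = 2 * ⌊(1 - δ) * (L : ℝ) ^ 2 / 2⌋₊ ∧ star (ψ L) ⬝ᵥ ψ L = 1 ∧ Literature.MathematicalPhysics.QuantumLattice.IsGroundStateInSector (Literature.MathematicalPhysics.QuantumLattice.hubbardTorus 2 L 1 U) (N L) 0 (ψ L)) → ∃ L₀ : ℕ, ∀ (L : ℕ) [NeZero L], Even L → L₀ ≤ L → let B := fun (x : Literature.Probability.LatticeModels.TorusSite 2 L) (e : Literature.Probability.LatticeModels.Site 2) => Literature.MathematicalPhysics.QuantumLattice.annihilation (Literature.MathematicalPhysics.QuantumLattice.orb (Literature.MathematicalPhysics.QuantumLattice.FermionTorus.ofTorusSite x) 0) * Literature.MathematicalPhysics.QuantumLattice.annihilation (Literature.MathematicalPhysics.QuantumLattice.orb (Literature.MathematicalPhysics.QuantumLattice.FermionTorus.ofTorusSite (x + Literature.Probability.LatticeModels.Torus.proj L e)) 1) - Literature.MathematicalPhysics.QuantumLattice.annihilation (Literature.MathematicalPhysics.QuantumLattice.orb (Literature.MathematicalPhysics.QuantumLattice.FermionTorus.ofTorusSite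 x) 1) * Literature.MathematicalPhysics.QuantumLattice.annihilation (Literature.MathematicalPhysics.QuantumLattice.orb (Literature.MathematicalPhysics.QuantumLattice.FermionTorus.ofTorusSite (x + Literature.Probability.LatticeModels.Torus.proj L e)) 0); let P₂ := fun (x : Literature.Probability.LatticeModels.TorusSite 2 L) => ((1 / Real.sqrt 2 : ℝ) : ℂ) • (B x ![1, 1] + B x ![-1, -1] - B x ![1, -1] - B x ![-1, 1]); let P₁ := fun (x : Literature.Probability.LatticeModels.TorusSite 2 L) => Literature.MathematicalPhysics.QuantumLattice.localPair Literature.MathematicalPhysics.QuantumLattice.dWaveFormFactor L x; let X := ∑ x : Literature.Probability.LatticeModels.TorusSite 2 L, Complex.I • (Matrix.conjTranspose (P₁ x) * P₂ x - Matrix.conjTranspose (P₂ x) * P₁ x); c ≤ (Literature.MathematicalPhysics.QuantumLattice.expect (Matrix.conjTranspose X * X) (ψ L)).re / ((L : ℕ) : ℝ) ^ 4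

/-- item stmt-HubbardSuperconductivity-10439 · crux · rank 6 · open · by planner
why it might fail: SSB under a source (L→∞ then h↓0) ⇒ LRO of EVERY finite-volume sector GS is the unproved Koma–Tasaki direction (KT1994 §2.5: only μ₁≥μ₂; Conj. 10); a density-matched sector GS may sit in a coexisting phase at a first-order edge (d/χ*), or towers mix.
sources: KomaTasaki1994 (arXiv:cond-mat/9708132 §2.5 p. 11, Conjecture 10), Tasaki2019Tower (arXiv:1807.05847 §1, §3.2), WreszinskiZagrebnov2016 (arXiv:1607.03024 Remark 4.5), RaghuKivelsonScalapino2010 (arXiv:1002.0591 §III Fig. 2), KaplanHorschVonDerLinden1989, Literature.Barriers.HubbardSuperconductivity.LROForcesLowLyingStates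
[crux] Transfer, weak-coupling window (rev 2): ∃U₀>0 ∀U∈(0,U₀) ∀δ∈(0,1/2) ∀μ: IF the grand-canonical
tracial ground-state density Re ω₀(N)/(L+1)² of hubbardTorusWith 2 (L+1) 1 U μ tends to 1-δ AND
Koma–Tasaki d-wave order HasDWaveOrder U μ holds (0 < liminf_{h↓0} liminf_L Re ω_{L,h}(Δ_d)/L²;
source -h(Δ_d+Δ_d†), L→∞ FIRST) THEN the summit's matrix at (U, δ): every normalised even-L (N_L,
S^z=0)-sector ground-state sequence of the source-free canonical model hubbardTorus 2 L 1 U, N_L =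
2⌊(1-δ)L²/2⌋, has d_{x²-y²} pair-field LRO (HasLongRangeOrder of torusPullback (pairFieldCorr
dWaveFormFactor ψ) (2k) over halfOpenBox 2 (2k); matrix inlined, no barrier import). Word for word
WeakCouplingBCS's WcbcsSsbToTorusLRO (stmt-2009) with HasDWavePairFieldLROAt unfolded (Iff.rfl,
planner's SketchEquiv.lean): a proof or refutation of either settles the other. Supersedes rev-1
stmt-1742 (∀U>0 ∀δ<1/2: strictly stronger than CwGlue needs and exposed to strong-U stripe physics;
three refuter reviews asked for this weakening; old ⇒ new). Only the converse (LRO ⇒ SSB / low-lying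
states) is a theorem (KomaTasaki1994 Thm 2.2, LROForcesLowLyingStates_holds). In the chiral window
the bulk is fully gapped -/
@[route_item "route-HubbardSuperconductivity-VestigialChirality"]
def SsbToEvenTorusLRO : Prop :=
  ∃ U₀ : ℝ, 0 < U₀ ∧ ∀ U ∈ Set.Ioo (0:ℝ) U₀, ∀ δ ∈ Set.Ioo (0:ℝ) (1 / 2), ∀ μ : ℝ, Filter.Tendsto (fun L : ℕ => ((Literature.MathematicalPhysics.QuantumLattice.hubbardTorusWith 2 (L + 1) 1 U μ).groundStateFunctional Literature.MathematicalPhysics.QuantumLattice.totalNumber).re / ((L + 1 : ℕ) : ℝ) ^ 2) Filter.atTop (nhds (1 - δ)) → Literature.MathematicalPhysics.QuantumLattice.HasDWaveOrder U μ → ∀ (N : ℕ → ℕ) (ψ : ∀ L, Literature.MathematicalPhysics.QuantumLattice.Fock (Literature.MathematicalPhysics.QuantumLattice.Orb (Literature.MathematicalPhysics.QuantumLattice.FermionTorus 2 L))), (∀ L, Even L → N L = 2 * ⌊(1 - δ) * (L : ℝ) ^ 2 / 2⌋₊ ∧ star (ψ L) ⬝ᵥ ψ L = 1 ∧ Literature.MathematicalPhysics.QuantumLattice.IsGroundStateInSector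 (Literature.MathematicalPhysics.QuantumLattice.hubbardTorus 2 L 1 U) (N L) 0 (ψ L)) → Literature.Probability.LatticeModels.HasLongRangeOrder (fun k => Literature.Probability.LatticeModels.halfOpenBox 2 (2 * k)) (fun k => Literature.MathematicalPhysics.QuantumLattice.torusPullback (Literature.MathematicalPhysics.QuantumLattice.pairFieldCorr Literature.MathematicalPhysics.QuantumLattice.dWaveFormFactor ψ) (2 * k))

/-- item stmt-HubbardSuperconductivity-14381 · support · rank 9 · closed · proved by Summit.HubbardSuperconductivity.HubbardSuperconductivity.Theorems.targetGlue_proof (prover) · by planner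
sources: Scalapino1995, KomaTasaki1994
[support] Pure-logic glue that makes the target reachable (route-choice repair 2026-08-16, option
(a) 'add glue item(s) Crux... -> Target'): ChiralPointDWaveOrder -> SsbToEvenTorusLRO -> Target.
Proof (kernel-checked in the planner's Sketch.lean, theorem targetGlue_holds, 5 lines, standard
axioms): given U0 > 0, apply ChiralPointDWaveOrder at min(U0, U1) with U1 the weak-coupling window
of SsbToEvenTorusLRO; the point (U, delta, mu, c) gives conjunct (i) of Target (pair-chirality LRO
of every sector GS) directly and conjunct (ii) (d_(x2-y2) pair-field LRO of every sector GS) through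
the transfer at (U, delta, mu). With `closes (hT : Target)` the route now decides the summit from
its cruxes: ChiralPointDWaveOrder, SsbToEvenTorusLRO |- Target |- HubbardSuperconductivity. [deps:
ChiralPointDWaveOrder, SsbToEvenTorusLRO] [difficulty: provable-now] -/
@[route_item "route-HubbardSuperconductivity-VestigialChirality"]
def TargetGlue : Prop :=
  Summit.HubbardSuperconductivity.HubbardSuperconductivity.Theses.VestigialChirality.ChiralPointDWaveOrder → Summit.HubbardSuperconductivity.HubbardSuperconductivity.Theses.VestigialChirality.SsbToEvenTorusLRO → Summit.HubbardSuperconductivity.HubbardSuperconductivity.Theses.VestigialChirality.Target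

/-- item stmt-HubbardSuperconductivity-2420 · support · rank 9 · closed · proved by Summit.HubbardSuperconductivity.HubbardSuperconductivity.Theorems.chiralSelectionOddMoments_proof @ 9cd7f27d06c4 (prover) · by planner
sources: SigristUeda1991, FrankLemm2016, RaghuKivelsonScalapino2010
[support] chiral-not-nematic is automatic in weak coupling (settles the card's fastest refutation
(a)): for g1 in B1g and g2 in B2g the A2g-odd Fermi-curve moments Int g1^3 g2 dmu_F and Int g1 g2^3
dmu_F vanish (mu_F = fermiCurveMeasure of the D4-symmetric t'=0 band, invariant under the axis
reflection under which g1 is even and g2 odd; Bochner junk 0 covers non-integrable cases), so the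
quartic GL term is const + 4 s^2 t^2 cos^2(phi) Int g1^2 g2^2, minimised at phi = +-pi/2, and (Int
g1^2 g2^2)^2 < Int g1^4 Int g2^4 (Cauchy-Schwarz) is the coexistence condition. [difficulty:
provable-now] -/
@[route_item "route-HubbardSuperconductivity-VestigialChirality"]
def ChiralSelectionOddMoments : Prop :=
  ∀ (μ : ℝ) (g₁ g₂ : Literature.MathematicalPhysics.QuantumLattice.Momentum → ℝ), Literature.MathematicalPhysics.QuantumLattice.InChannel Literature.MathematicalPhysics.QuantumLattice.D4Irrep.B1g g₁ → Literature.MathematicalPhysics.QuantumLattice.InChannel Literature.MathematicalPhysics.QuantumLattice.D4Irrep.B2g g₂ → (∫ k, g₁ k ^ 3 * g₂ k ∂Literature.MathematicalPhysics.QuantumLattice.fermiCurveMeasure (Literature.MathematicalPhysics.QuantumLattice.squareDispersion 1 0) μ) = 0 ∧ (∫ k, g₁ k * g₂ k ^ 3 ∂Literature.MathematicalPhysics.QuantumLattice.fermiCurveMeasure (Literature.MathematicalPhysics.QuantumLattice.squareDispersion 1 0) μ) = 0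

-- item stmt-HubbardSuperconductivity-2591 · support · rank 9 · open · by planner — informal only, no Lean statement yet:
--   [support] TWIST COVARIANCE OF THE SHADOW (card gain G3, corrected per the novelty audit; provable
--   now, CAR algebra only). For θ ∈ ℝ let U_θ := the diagonal unitary exp(i θ Σ_x x₀ n_x) on
--   Fock((ℤ/Lℤ)²) (x₀ ∈ {0,…,L−1} the first coordinate of the representative; θ = 2πj/L makes it
--   L-periodic — the gauge twist that defeats every L-uniform local certificate for Δ_d†Δ_d, card
--   twist-witness-no-local-certificate / stmt-HubbardSuperconductivity-0178). CLAIM: for every L ≥ 3, x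
--   and θ, the pair-chirality density O_χ(x) = i(P₁(x)ᴴP₂(x) − P₂(x)ᴴP₁(x)) (P₁ = localPair
--   dWaveFormFactor L x, P₂ = the B2g diag

/-- item stmt-HubbardSuperconductivity-2421 · assembly · rank 1 · closed · proved by Summit.HubbardSuperconductivity.HubbardSuperconductivity.Theorems.vestigialChirality_assembly_proof @ b6780efc65f0 (prover) · by planner
sources: Scalapino1995, ArovasBergKivelsonRaghu2022
[assembly] Target -> HubbardSuperconductivity (instantiate U0 := 1, drop the shadow conjunct). -/
@[route_item "route-HubbardSuperconductivity-VestigialChirality"]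
def Assembly : Prop :=
  (∀ U₀ : ℝ, 0 < U₀ → ∃ U ∈ Set.Ioo (0 : ℝ) U₀, ∃ δ ∈ Set.Ioo (0 : ℝ) (1 / 2), ∃ c : ℝ, 0 < c ∧ ∀ (N : ℕ → ℕ) (ψ : ∀ L, Literature.MathematicalPhysics.QuantumLattice.Fock (Literature.MathematicalPhysics.QuantumLattice.Orb (Literature.MathematicalPhysics.QuantumLattice.FermionTorus 2 L))), (∀ L, Even L → N L = 2 * ⌊(1 - δ) * (L : ℝ) ^ 2 / 2⌋₊ ∧ star (ψ L) ⬝ᵥ ψ L = 1 ∧ Literature.MathematicalPhysics.QuantumLattice.IsGroundStateInSector (Literature.MathematicalPhysics.QuantumLattice.hubbardTorus 2 L 1 U) (N L) 0 (ψ L)) → (∃ L₀ : ℕ, ∀ (L : ℕ) [NeZero L], Even L → L₀ ≤ L → let B := fun (x : Literature.Probability.LatticeModels.TorusSite 2 L) (e : Literature.Probability.LatticeModels.Site 2) => Literature.MathematicalPhysics.QuantumLattice.annihilation (Literature.MathematicalPhysics.QuantumLattice.orb (Literature.MathematicalPhysics.QuantumLattice.FermionTorus.ofTorusSite x) 0)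 * Literature.MathematicalPhysics.QuantumLattice.annihilation (Literature.MathematicalPhysics.QuantumLattice.orb (Literature.MathematicalPhysics.QuantumLattice.FermionTorus.ofTorusSite (x + Literature.Probability.LatticeModels.Torus.proj L e)) 1) - Literature.MathematicalPhysics.QuantumLattice.annihilation (Literature.MathematicalPhysics.QuantumLattice.orb (Literature.MathematicalPhysics.QuantumLattice.FermionTorus.ofTorusSite x) 1) * Literature.MathematicalPhysics.QuantumLattice.annihilation (Literature.MathematicalPhysics.QuantumLattice.orb (Literature.MathematicalPhysics.QuantumLattice.FermionTorus.ofTorusSite (x + Literature.Probability.LatticeModels.Torus.proj L e)) 0); let P₂ := fun (x : Literature.Probability.LatticeModels.TorusSite 2 L) => ((1 / Real.sqrt 2 : ℝ) : ℂ) • (B x ![1, 1] + B x ![-1, -1] - B x ![1, -1] - B x ![-1, 1]); let P₁ := fun (x : Literature.Probability.LatticeModels.TorusSite 2 L) => Literature.MathematicalPhysics.QuantumLattice.localPair Literature.MathematicalPhysics.QuantumLattice.dWaveFormFactor L x; let X := ∑ x : Literature.Probability.LatticeModels.TorusSite 2 L, Complex.I • (Matrix.conjTranspose (P₁ x) * P₂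 x - Matrix.conjTranspose (P₂ x) * P₁ x); c ≤ (Literature.MathematicalPhysics.QuantumLattice.expect (Matrix.conjTranspose X * X) (ψ L)).re / ((L : ℕ) : ℝ) ^ 4) ∧ Literature.Probability.LatticeModels.HasLongRangeOrder (fun k => Literature.Probability.LatticeModels.halfOpenBox 2 (2 * k)) (fun k => Literature.MathematicalPhysics.QuantumLattice.torusPullback (Literature.MathematicalPhysics.QuantumLattice.pairFieldCorr Literature.MathematicalPhysics.QuantumLattice.dWaveFormFactor ψ) (2 * k))) → HubbardSuperconductivity

/-! D-0027 §2.1 — DECIDING THEOREM (planner-authored via `route open/edit --closes-file`; by planner-rbadge-HubbardSuperconductivity-Vestig-ff9d94ae-g2-0 2026-08-15T16:18:42Z):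
its hypotheses are this route's items and its conclusion the sub-problem Statement (glue_lint), and it elaborates with this file. -/

@[closes "route-HubbardSuperconductivity-VestigialChirality"] theorem closes (hT : Target) : _root_.HubbardSuperconductivity := by
  obtain ⟨U, hU, δ, hδ, c, _hc, h⟩ := hT 1 one_pos
  exact ⟨U, hU.1, δ, hδ, fun N ψ hNψ => (h N ψ hNψ).2⟩

end Summit.HubbardSuperconductivity.HubbardSuperconductivity.Theses.VestigialChirality
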